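import Literature.LinearAlgebra.Matrix.ModularDiagonalSolver
import Literature.LinearAlgebra.Matrix.RowLatticeSelection
import Mathlib.LinearAlgebra.Dimension.Finite
import Mathlib.LinearAlgebra.FreeModule.Finite.Basic
import HarnessLib

/-!
# Deciding solvability of a system of linear Diophantine equations `A x = b`, `x ∈ ℤᶜ`

Topic `Literature/LinearAlgebra/Matrix`.  The decision procedure behind "a system of polynomially
many linear equations over `ℤ` is solvable in polynomial time" (Kannan–Bachem 1979; the route taken
here is the modular one of Schrijver 1986, §5.3 / Domich–Kannan–Trotter 1987), as a total functional
program `IntSolve.intSolvable D c A b : Bool` on an integer matrix given by its LIST OF ROWS `A`, a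
right hand side `b` and the number of unknowns `c`, parametrised by a determinant routine `D`
(`RowSelect.DetCorrect D`; e.g. the polynomial-time `IntDetFP.detZ`), with its correctness theorem
**`intSolvable_iff`**: `intSolvable D c (rows A) (List.ofFn b) = true ↔ ∃ x : Fin c → ℤ, A *ᵥ x = b`.

The program:
1. forms the augmented rows `[aᵢ | bᵢ]` and selects greedily a maximal linearly independent sublist
   `S` of them by Gram-determinant tests (`RowSelect.greedy`, Regev-style scan of
   `RowLatticeSelection.lean`); every augmented row then lies in the real span of `S`, so
   `A x = b ⇔ A_S x = b_S`;
2. rejects unless the COEFFICIENT parts of `S` are still independent (otherwise `rank [A|b] > rank A`,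
   no rational solution);
3. takes `m = |det (A_S A_Sᵀ)| ≥ 1`; since `m ℤ^S = A_S (A_Sᵀ adj(A_S A_Sᵀ)) ℤ^S ⊆ A_S ℤᶜ`, one has
   `b_S ∈ A_S ℤᶜ ⇔ A_S x ≡ b_S (mod m)` is solvable;
4. decides the latter by diagonalisation modulo `m` (`ModDiag.solve`, `ModularDiagonalSolver.lean`).

Everything is proved; no named facts.  The machine realisation (all steps are list programs with
polynomially many arithmetic operations on numbers of polynomially many bits) is
`Literature/Computability/Complexity/IntegerLinearSolvabilityFP.lean`.

## References

* R. Kannan, A. Bachem, *Polynomial algorithms for computing the Smith and Hermite normal forms of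
  an integer matrix*, SIAM J. Comput. 8 (1979) 499–507 [KannanBachem1979] — the result (polynomial
  time solvability of linear Diophantine systems); the algorithm here is the modular variant.
* A. Schrijver, *Theory of Linear and Integer Programming*, Wiley 1986 [Schrijver1986], Cor. 4.1c and
  §5.3 (integer solvability via unimodular transformations; reduction modulo a subdeterminant).
-/

namespace Literature.LinearAlgebra.Matrix

namespace IntSolve

open _root_.Matrix Finset Berkowitz RowSelect ModDiag

variable (D : List (List ℤ) → ℤ)

/-! ### The program -/

/-- The augmented rows `[aᵢ | bᵢ]`. [folklore] -/
def aug (A : List (List ℤ)) (b : List ℤ) : List (List ℤ) := List.zipWith (fun r x => r ++ [x]) A b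

/-- The selected augmented rows: a greedy maximal independent sublist (cap = row length `c + 1`).
[cite: Schrijver1986, §5.3 (method)] -/
def sel (c : ℕ) (A : List (List ℤ)) (b : List ℤ) : List (List ℤ) := greedy D (c + 1) (aug A b)

/-- The coefficient parts (first `c` entries) of a list of augmented rows. [folklore] -/
def coefs (c : ℕ) (S : List (List ℤ)) : List (List ℤ) := S.map (List.take c)

/-- The modulus parameter `N` with `N + 1 = |det (A_S A_Sᵀ)|`. [cite: Schrijver1986, §5.3 (method)] -/
def modN (c : ℕ) (S : List (List ℤ)) : ℕ := (D (gram (coefs c S))).natAbs - 1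

/-- An integer row reduced modulo `N + 1`. [folklore] -/
def residues (N : ℕ) (r : List ℤ) : List ℕ := r.map (zmodNat N)

/-- **The decision procedure for `∃ x ∈ ℤᶜ, A x = b`.** [cite: KannanBachem1979, Thm. 4 (result); Schrijver1986, §5.3 (method)] -/
def intSolvable (c : ℕ) (A : List (List ℤ)) (b : List ℤ) : Bool :=
  indepTest D (coefs c (sel D c A b)) &&
    ModDiag.solve (modN D c (sel D c A b)) (2 * Nat.size (modN D c (sel D c A b)) + 1)
      (Nat.size (modN D c (sel D c A b))) ((sel D c A b).length + 1)
      ((c, (sel D c A b).map (residues (modN D c (sel D c A b)))), true)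

variable {D}

/-! ### Augmented matrices as row lists -/

section Aug

variable {m c : ℕ}

/-- The augmented matrix `[A | b]`. [folklore] -/
def augM (A : Matrix (Fin m) (Fin c) ℤ) (b : Fin m → ℤ) : Matrix (Fin m) (Fin (c + 1)) ℤ :=
  fun i => Fin.snoc (A i) (b i)

/-- `List.ofFn` of a `Fin.snoc`. [folklore] -/
theorem ofFn_snoc {α : Type*} {n : ℕ} (f : Fin n → α) (a : α) :
    List.ofFn (Fin.snoc f a : Fin (n + 1) → α) = List.ofFn f ++ [a] := by
  rw [List.ofFn_succ', List.concat_eq_append]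
  simp

/-- The augmented rows of `rows A`, `List.ofFn b` are the rows of `[A | b]`. [folklore] -/
theorem aug_rows (A : Matrix (Fin m) (Fin c) ℤ) (b : Fin m → ℤ) :
    aug (rows A) (List.ofFn b) = rows (augM A b) := by
  unfold aug rows augM
  rw [zipWith_ofFn]
  congr 1
  funext i
  exact (ofFn_snoc (A i) (b i)).symm

/-- The coefficient part of an augmented row. [folklore] -/
theorem take_ofFn_augM (A : Matrix (Fin m) (Fin c) ℤ) (b : Fin m → ℤ) (i : Fin m) :
    (List.ofFn (augM A b i)).take c = List.ofFn (A i) := by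
  unfold augM; rw [ofFn_snoc, List.take_append_of_le_length (by simp), List.take_of_length_le (by simp)]

/-- Entries of an augmented row: coefficients. [folklore] -/
theorem getD_ofFn_augM_lt (A : Matrix (Fin m) (Fin c) ℤ) (b : Fin m → ℤ) (i : Fin m) (j : Fin c) :
    (List.ofFn (augM A b i)).getD j 0 = A i j := by
  rw [getD_ofFn, dif_pos (by omega)]
  unfold augM
  have : (⟨(j : ℕ), (by omega : (j : ℕ) < c + 1)⟩ : Fin (c + 1)) = Fin.castSucc j := rfl
  rw [this, Fin.snoc_castSucc]

/-- Entries of an augmented row: the right hand side. [folklore] -/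
theorem getD_ofFn_augM_last (A : Matrix (Fin m) (Fin c) ℤ) (b : Fin m → ℤ) (i : Fin m) :
    (List.ofFn (augM A b i)).getD c 0 = b i := by
  rw [getD_ofFn, dif_pos (by omega)]
  unfold augM
  have : (⟨c, (by omega : c < c + 1)⟩ : Fin (c + 1)) = Fin.last c := rfl
  rw [this, Fin.snoc_last]

/-- The dot product of an augmented row with `(y, -1)` is `aᵢ ⬝ y - bᵢ` (over any commutative ring,
after a ring homomorphism `φ`). [folklore] -/
theorem augM_dotProduct_snoc {R : Type*} [CommRing R] (φ : ℤ →+* R) (A : Matrix (Fin m) (Fin c) ℤ)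
    (b : Fin m → ℤ) (i : Fin m) (y : Fin c → R) :
    (fun j => φ (augM A b i j)) ⬝ᵥ (Fin.snoc y (-1) : Fin (c + 1) → R) = (fun j => φ (A i j)) ⬝ᵥ y - φ (b i) := by
  unfold augM
  rw [dotProduct, Fin.sum_univ_castSucc]
  simp only [Fin.snoc_castSucc, Fin.snoc_last, mul_neg, mul_one]
  rw [dotProduct, sub_eq_add_neg]

end Aug

/-! ### From a sublist of rows to a matrix of selected rows -/

section Select

variable {m n : ℕ}

/-- A list of rows of `M` (each member is some row) is the row list of a selection `M ∘ σ`.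
[folklore] -/
theorem exists_sel_of_forall_mem (M : Matrix (Fin m) (Fin n) ℤ) (S : List (List ℤ))
    (hS : ∀ s ∈ S, s ∈ rows M) :
    ∃ σ : Fin S.length → Fin m, rows (fun l => M (σ l)) = S := by
  have key : ∀ l : Fin S.length, ∃ i : Fin m, List.ofFn (M i) = S.get l := by
    intro l
    have := hS _ (List.get_mem S l)
    rw [rows, List.mem_ofFn] at this
    obtain ⟨i, hi⟩ := this
    exact ⟨i, hi⟩
  choose σ hσ using key
  refine ⟨σ, ?_⟩
  unfold rows
  apply List.ext_get (by simp)
  intro l h₁ h₂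
  rw [List.get_ofFn]
  exact hσ ⟨l, h₂⟩

end Select

/-! ### Gram determinants over `ℝ` and the cap of the greedy scan -/

section Gram

variable {k n : ℕ}

/-- A non-zero Gram determinant makes the rows linearly independent — over any field, for the cast
matrix (the adjugate argument of `RowSelect.linearIndependent_of_det_mul_transpose_ne_zero`).
[folklore] -/
theorem linearIndependent_real_of_det_gram_ne_zero (T : Matrix (Fin k) (Fin n) ℤ) (h : (T * Tᵀ).det ≠ 0) :
    LinearIndependent ℝ (fun i => fun j => (T i j : ℝ)) := by
  let TR : Matrix (Fin k) (Fin n) ℝ := T.map (Int.castRingHom ℝ)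
  have hR : (TR * TRᵀ).det ≠ 0 := by
    have e : TR * TRᵀ = (Int.castRingHom ℝ).mapMatrix (T * Tᵀ) := by
      rw [RingHom.mapMatrix_apply, Matrix.map_mul, Matrix.transpose_map]
    rw [e, ← RingHom.map_det, eq_intCast]
    exact_mod_cast h
  have : (fun i => fun j => (T i j : ℝ)) = fun i => TR i := rfl
  rw [this, Fintype.linearIndependent_iff]
  intro c hc i
  have hcT : c ᵥ* TR = 0 := by rw [Matrix.vecMul_eq_sum]; exact hc
  have h1 : (TR * TRᵀ) *ᵥ c = 0 := by
    rw [← Matrix.mulVec_mulVec, Matrix.mulVec_transpose, hcT, Matrix.mulVec_zero]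
  have h2 : (TR * TRᵀ).det • c = 0 := by
    have := congrArg (fun w => (TR * TRᵀ).adjugate *ᵥ w) h1
    simp only [Matrix.mulVec_mulVec, Matrix.adjugate_mul, Matrix.mulVec_zero, Matrix.smul_mulVec,
      Matrix.one_mulVec] at this
    exact this
  have := congrFun h2 i
  simp only [Pi.smul_apply, smul_eq_mul, Pi.zero_apply, mul_eq_zero] at this
  exact this.resolve_left hR

/-- `c + 1` integer vectors of length `c` never pass the independence test. [folklore] -/
theorem indepTest_eq_false_of_card (hD : DetCorrect D) {c : ℕ} (T : Matrix (Fin (c + 1)) (Fin c) ℤ) :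
    indepTest D (rows T) = false := by
  by_contra h
  rw [Bool.not_eq_false, indepTest_rows_iff hD] at h
  have := h.fintype_card_le_finrank
  rw [Module.finrank_fin_fun, Fintype.card_fin] at this
  omega

end Gram

/-! ### Residues and satisfaction -/

section Residues

variable {N c : ℕ}

/-- The reduced representative is congruent to the integer. [folklore] -/
theorem cast_zmodNat_modEq (N : ℕ) (z : ℤ) : ((zmodNat N z : ℕ) : ℤ) ≡ z [ZMOD ((N : ℤ) + 1)] := by
  rw [zmodNat, Int.toNat_of_nonneg (Int.emod_nonneg _ (by omega))]
  exact Int.mod_modEq _ _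

/-- The reduced representative is a residue. [folklore] -/
theorem zmodNat_lt (N : ℕ) (z : ℤ) : zmodNat N z < N + 1 := by
  rw [zmodNat]
  have h1 : z % ((N : ℤ) + 1) < (N : ℤ) + 1 := Int.emod_lt_of_pos _ (by omega)
  have h0 : 0 ≤ z % ((N : ℤ) + 1) := Int.emod_nonneg _ (by omega)
  omega

/-- Entries of a residue row. [folklore] -/
theorem ent_residues (N : ℕ) (r : List ℤ) (i : ℕ) : ent (residues N r) i ≡ r.getD i 0 [ZMOD ((N : ℤ) + 1)] := by
  unfold ent residues
  rw [List.getD_eq_getElem?_getD, List.getElem?_map]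
  cases hri : r[i]? with
  | none => rw [List.getD_eq_getElem?_getD, hri]; simp
  | some a =>
    rw [List.getD_eq_getElem?_getD, hri]
    simpa using cast_zmodNat_modEq N a

/-- **Satisfaction of a residue row** is the congruence of the integer row. [folklore] -/
theorem sat_residues_iff (N c : ℕ) (x : ℕ → ℤ) (r : List ℤ) :
    Sat N c x (residues N r) ↔ (∑ j : Fin c, r.getD j 0 * x j) ≡ r.getD c 0 [ZMOD ((N : ℤ) + 1)] := by
  unfold Sat
  have hl : (∑ j : Fin c, ent (residues N r) j * x j) ≡ ∑ j : Fin c, r.getD j 0 * x j [ZMOD ((N : ℤ) + 1)] :=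
    Int.ModEq.sum fun j _ => (ent_residues N r j).mul_right _
  have hr := ent_residues N r c
  exact ⟨fun h => (hl.symm.trans h).trans hr, fun h => (hl.trans h).trans hr.symm⟩

/-- Residue rows of augmented rows are well-formed. [folklore] -/
theorem wf_residues {m : ℕ} (S : List (List ℤ)) (hS : ∀ s ∈ S, s.length = m + 1) :
    WF m (S.map (residues N)) := by
  intro r hr
  obtain ⟨s, hs, rfl⟩ := List.mem_map.1 hr
  unfold residues; rw [List.length_map, hS s hs]

/-- Residue rows are reduced. [folklore] -/
theorem reduced_residues (S : List (List ℤ)) : Reduced N (S.map (residues N)) := by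
  intro r hr a ha
  obtain ⟨s, hs, rfl⟩ := List.mem_map.1 hr
  unfold residues at ha
  obtain ⟨z, -, rfl⟩ := List.mem_map.1 ha
  exact zmodNat_lt N z

end Residues

/-! ### The lattice argument: `m ℤ^S ⊆ A_S ℤᶜ` -/

section Lattice

variable {k c : ℕ}

/-- **`det (T Tᵀ) • y` is in the column lattice of `T`** for every integer `y`:
`T (Tᵀ adj(T Tᵀ) y) = det (T Tᵀ) • y`. [cite: Schrijver1986, §5.3 (method)] -/
theorem exists_mulVec_eq_det_smul (T : Matrix (Fin k) (Fin c) ℤ) (y : Fin k → ℤ) :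
    ∃ z : Fin c → ℤ, T *ᵥ z = (T * Tᵀ).det • y := by
  refine ⟨Tᵀ *ᵥ ((T * Tᵀ).adjugate *ᵥ y), ?_⟩
  rw [Matrix.mulVec_mulVec, Matrix.mulVec_mulVec, Matrix.mul_adjugate, Matrix.smul_mulVec,
    Matrix.one_mulVec]

/-- **From a solution modulo `|det (T Tᵀ)|` to an integer solution** of `T x = β`. [cite: Schrijver1986, §5.3] -/
theorem exists_mulVec_eq_of_modEq (T : Matrix (Fin k) (Fin c) ℤ) (β : Fin k → ℤ) (x : Fin c → ℤ)
    (h : ∀ l, (T *ᵥ x) l ≡ β l [ZMOD (T * Tᵀ).det]) : ∃ x' : Fin c → ℤ, T *ᵥ x' = β := by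
  have hy : ∀ l, ∃ y, β l - (T *ᵥ x) l = (T * Tᵀ).det * y := fun l => Int.modEq_iff_dvd.1 (h l)
  choose y hy using hy
  obtain ⟨z, hz⟩ := exists_mulVec_eq_det_smul T y
  refine ⟨x + z, ?_⟩
  funext l
  rw [Matrix.mulVec_add, Pi.add_apply, hz, Pi.smul_apply, smul_eq_mul, ← hy l]
  ring

end Lattice

/-! ### Correctness -/

section Correct

variable {m c k : ℕ}

/-- The kernel of `v ↦ v ⬝ᵥ y` as a submodule. [folklore] -/
def orthSubmodule {n : ℕ} (y : Fin n → ℝ) : Submodule ℝ (Fin n → ℝ) where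
  carrier := {v | v ⬝ᵥ y = 0}
  add_mem' := by intro a b ha hb; simp only [Set.mem_setOf_eq] at *; rw [add_dotProduct, ha, hb, add_zero]
  zero_mem' := by simp
  smul_mem' := by intro r a ha; simp only [Set.mem_setOf_eq] at *; rw [smul_dotProduct, ha, smul_zero]

/-- **If the augmented rows `[T' | T' x]` are independent then so are the rows of `T'`.** [folklore] -/
theorem linearIndependent_of_augM (T' : Matrix (Fin k) (Fin c) ℤ) (x : Fin c → ℤ)
    (h : LinearIndependent ℤ (fun l => augM T' (T' *ᵥ x) l)) : LinearIndependent ℤ (fun l => T' l) := by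
  rw [Fintype.linearIndependent_iff] at h ⊢
  intro g hg l
  apply h g
  have hgj : ∀ j' : Fin c, ∑ l', g l' * T' l' j' = 0 := fun j' => by
    have := congrFun hg j'
    simpa [Finset.sum_apply, Pi.smul_apply, smul_eq_mul] using this
  funext j
  simp only [Finset.sum_apply, Pi.smul_apply, smul_eq_mul, Pi.zero_apply]
  refine Fin.lastCases ?_ (fun j' => ?_) j
  · simp only [augM, Fin.snoc_last]
    calc ∑ l', g l' * (T' *ᵥ x) l' = ∑ l', ∑ j', g l' * (T' l' j' * x j') := by
          refine Finset.sum_congr rfl fun l' _ => ?_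
          rw [Matrix.mulVec, dotProduct, Finset.mul_sum]
      _ = ∑ j', ∑ l', g l' * (T' l' j' * x j') := Finset.sum_comm
      _ = ∑ j', (∑ l', g l' * T' l' j') * x j' := by
          refine Finset.sum_congr rfl fun j' _ => ?_
          rw [Finset.sum_mul]
          exact Finset.sum_congr rfl fun l' _ => by ring
      _ = 0 := Finset.sum_eq_zero fun j' _ => by rw [hgj j', zero_mul]
  · simp only [augM, Fin.snoc_castSucc]
    exact hgj j'

/-- **From solvability of the selected rows modulo `|det (T' T'ᵀ)|` to an integer solution of the
selected equations.** [cite: Schrijver1986, §5.3 (method)] -/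
theorem exists_mulVec_eq_of_solvable (T' : Matrix (Fin k) (Fin c) ℤ) (β : Fin k → ℤ) {N : ℕ}
    (hN : ((N : ℤ) + 1) = |(T' * T'ᵀ).det|) (h : Solvable N c ((rows (augM T' β)).map (residues N))) :
    ∃ x' : Fin c → ℤ, T' *ᵥ x' = β := by
  obtain ⟨x, hx⟩ := h
  apply exists_mulVec_eq_of_modEq T' β (fun j : Fin c => x j)
  intro l
  have hs : List.ofFn (augM T' β l) ∈ rows (augM T' β) := by
    rw [rows, List.mem_ofFn]; exact ⟨l, rfl⟩
  have h1 := (sat_residues_iff N c x _).1 (hx _ (List.mem_map_of_mem hs))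
  simp only [getD_ofFn_augM_lt, getD_ofFn_augM_last] at h1
  rw [hN, Int.modEq_abs] at h1
  exact h1

/-- **If the selected rows span all augmented rows (over `ℝ`), a solution of the selected equations
solves the whole system.** [cite: Schrijver1986, Cor. 4.1c (method)] -/
theorem mulVec_eq_of_realSpan (A : Matrix (Fin m) (Fin c) ℤ) (b : Fin m → ℤ) (σ : Fin k → Fin m)
    (hspan : realSpan (c + 1) (rows (augM A b)) ≤ realSpan (c + 1) (rows (augM (fun l => A (σ l)) (fun l => b (σ l)))))
    (x' : Fin c → ℤ) (hx' : (fun l => A (σ l) : Matrix (Fin k) (Fin c) ℤ) *ᵥ x' = fun l => b (σ l)) :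
    A *ᵥ x' = b := by
  funext i
  let y : Fin (c + 1) → ℝ := Fin.snoc (fun j => (x' j : ℝ)) (-1)
  have hK : realSpan (c + 1) (rows (augM (fun l => A (σ l)) (fun l => b (σ l)))) ≤ orthSubmodule y := by
    refine Submodule.span_le.2 ?_
    rintro v ⟨s, hs, w, hw, rfl⟩
    rw [rows, List.mem_ofFn] at hs
    obtain ⟨l, hl⟩ := hs
    have hwl : w = augM (fun l => A (σ l)) (fun l => b (σ l)) l := List.ofFn_injective (hw.trans hl.symm)
    subst hwl
    show (fun j => ((augM (fun l => A (σ l)) (fun l => b (σ l)) l j : ℤ) : ℝ)) ⬝ᵥ y = 0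
    have e := augM_dotProduct_snoc (Int.castRingHom ℝ) (fun l => A (σ l)) (fun l => b (σ l)) l (fun j => (x' j : ℝ))
    simp only [eq_intCast] at e
    rw [e, sub_eq_zero]
    have hl' := congrFun hx' l
    rw [Matrix.mulVec, dotProduct] at hl'
    have := congrArg (fun z : ℤ => (z : ℝ)) hl'
    push_cast at this
    rw [dotProduct]
    exact this
  have hrow : (fun j => ((augM A b i j : ℤ) : ℝ)) ∈ realSpan (c + 1) (rows (augM A b)) :=
    cast_mem_realSpan (by rw [rows, List.mem_ofFn]; exact ⟨i, rfl⟩)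
  have h0 : (fun j => ((augM A b i j : ℤ) : ℝ)) ⬝ᵥ y = 0 := hK (hspan hrow)
  have e := augM_dotProduct_snoc (Int.castRingHom ℝ) A b i (fun j => (x' j : ℝ))
  simp only [eq_intCast] at e
  rw [e, sub_eq_zero, dotProduct] at h0
  rw [Matrix.mulVec, dotProduct]
  exact_mod_cast h0

/-- **Soundness and completeness of `intSolvable`.** For a determinant routine `D`, an integer
`m × c` matrix `A` and `b ∈ ℤᵐ`: `intSolvable D c (rows A) (List.ofFn b) = true` iff `A x = b` has an
integer solution. [cite: KannanBachem1979, Thm. 4 (result); Schrijver1986, Cor. 4.1c, §5.3 (method)] -/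
theorem intSolvable_iff (hD : DetCorrect D) (A : Matrix (Fin m) (Fin c) ℤ) (b : Fin m → ℤ) :
    intSolvable D c (rows A) (List.ofFn b) = true ↔ ∃ x : Fin c → ℤ, A *ᵥ x = b := by
  -- the selected augmented rows `S`, as the rows of `augM T' β` for a selection `σ`
  have hSsel : sel D c (rows A) (List.ofFn b) = greedy D (c + 1) (rows (augM A b)) := by rw [sel, aug_rows]
  have hrowlen : ∀ v ∈ rows (augM A b), v.length = c + 1 := by
    intro v hv; rw [rows, List.mem_ofFn] at hv; obtain ⟨i, rfl⟩ := hv; simp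
  have hSsub : (sel D c (rows A) (List.ofFn b)).Sublist (rows (augM A b)) := hSsel ▸ greedy_sublist D (c + 1) _
  obtain ⟨σ, hσ⟩ := exists_sel_of_forall_mem (augM A b) _ (fun s hs => hSsub.subset hs)
  generalize hS : sel D c (rows A) (List.ofFn b) = S at hSsel hSsub σ hσ
  have hSlen : ∀ s ∈ S, s.length = c + 1 := fun s hs => hrowlen s (hSsub.subset hs)
  generalize hk : S.length = k at σ hσ
  let T' : Matrix (Fin k) (Fin c) ℤ := fun l => A (σ l)
  let β : Fin k → ℤ := fun l => b (σ l)
  have hσ' : rows (augM T' β) = S := hσ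
  have hcoefs : coefs c S = rows T' := by
    rw [coefs, ← hσ', rows, List.map_ofFn, rows]
    congr 1; funext l; simp only [Function.comp_apply]; exact take_ofFn_augM A b (σ l)
  have hdetT : D (gram (rows T')) = (T' * T'ᵀ).det := by rw [gram_rows, hD.det_rows]
  have hSind : S = [] ∨ indepTest D S = true := hSsel ▸ greedy_indepTest D (c + 1) _
  rw [intSolvable, hS, Bool.and_eq_true, hcoefs, hk]
  constructor
  · -- soundness
    rintro ⟨hind, hsolve⟩
    -- `k ≤ c`, so the greedy span property applies
    have hkc : k ≤ c := by
      by_contra hlt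
      have hk1 : k = c + 1 := by
        have h1 : k ≤ c + 1 := by rw [← hk, hSsel]; exact length_greedy_le hD _ hrowlen
        omega
      have key : ∀ (k' : ℕ) (M : Matrix (Fin k') (Fin c) ℤ), k' = c + 1 → indepTest D (rows M) = true → False := by
        intro k' M hk' hM
        subst hk'
        rw [indepTest_eq_false_of_card hD M] at hM
        exact Bool.false_ne_true hM
      exact key k T' hk1 hind
    have hspan : realSpan (c + 1) (rows (augM A b)) ≤ realSpan (c + 1) S := by
      obtain ⟨-, -, h3⟩ := greedy_invariant (D := D) hD (n := c + 1) (rows (augM A b)) [] [] hrowlen (by simp)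
        (Or.inl rfl) (by simp) (fun _ => by simp [realSpan])
      have h3' := h3 (by rw [← greedy, ← hSsel, hk]; omega)
      rwa [List.nil_append, ← greedy, ← hSsel] at h3'
    -- the modulus is `|det (T' T'ᵀ)| ≥ 1`
    have hdet0 : (T' * T'ᵀ).det ≠ 0 := by
      have := hind; rwa [indepTest, hdetT, decide_eq_true_iff] at this
    have hNsucc : ((modN D c S : ℤ) + 1) = |(T' * T'ᵀ).det| := by
      have h1 : modN D c S + 1 = (D (gram (coefs c S))).natAbs := by
        rw [modN]
        have : (D (gram (coefs c S))).natAbs ≠ 0 := by rw [hcoefs, hdetT]; exact Int.natAbs_ne_zero.2 hdet0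
        omega
      rw [hcoefs, hdetT] at h1
      have := congrArg (fun n : ℕ => (n : ℤ)) h1
      push_cast at this
      exact this
    -- the modular solver found a solution modulo `N + 1`; lift it and spread it to all rows
    have hsol : Solvable (modN D c S) c (S.map (residues (modN D c S))) :=
      (solve_eq_true_iff (wf_residues S hSlen) (reduced_residues S) le_rfl le_rfl (by simp [hk])).1 hsolve
    have hsol' : Solvable (modN D c S) c ((rows (augM T' β)).map (residues (modN D c S))) := by
      rw [hσ']; exact hsol
    rw [← hσ'] at hspan
    obtain ⟨x', hx'⟩ := exists_mulVec_eq_of_solvable T' β hNsucc hsol'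
    exact ⟨x', mulVec_eq_of_realSpan A b σ hspan x' hx'⟩
  · -- completeness
    rintro ⟨x, hx⟩
    have hβx : β = T' *ᵥ x := by
      funext l; show b (σ l) = _; rw [← hx]; rfl
    have hind : indepTest D (rows T') = true := by
      rcases hSind with hnil | hST
      · have hk0 : k = 0 := by rw [← hk, hnil]; rfl
        have key : ∀ (k' : ℕ) (M : Matrix (Fin k') (Fin c) ℤ), k' = 0 → indepTest D (rows M) = true := by
          intro k' M hk'; subst hk'
          rw [indepTest_rows_iff hD]; exact linearIndependent_empty_type
        exact key k T' hk0
      · rw [← hσ', indepTest_rows_iff hD, hβx] at hST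
        rw [indepTest_rows_iff hD]
        exact linearIndependent_of_augM T' x hST
    refine ⟨hind, ?_⟩
    apply (solve_eq_true_iff (wf_residues S hSlen) (reduced_residues S) le_rfl le_rfl (by simp [hk])).2
    refine ⟨fun j => if h : j < c then x ⟨j, h⟩ else 0, fun r hr => ?_⟩
    obtain ⟨s, hs, rfl⟩ := List.mem_map.1 hr
    rw [← hσ', rows, List.mem_ofFn] at hs
    obtain ⟨l, rfl⟩ := hs
    rw [sat_residues_iff]
    simp only [getD_ofFn_augM_lt, getD_ofFn_augM_last, Fin.is_lt, dif_pos, Fin.eta]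
    rw [hβx, Matrix.mulVec, dotProduct]

end Correct

end IntSolve

end Literature.LinearAlgebra.Matrix
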